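import Mathlib
import HarnessLib
import Summits.HubbardSuperconductivity.HubbardSuperconductivity.Theorems.KLProgrammeKLRegimeFatMultiplierPack
import Summits.HubbardSuperconductivity.HubbardSuperconductivity.Theorems.KLProgrammeH10TwoPointLimitFrameSectorOverlap

/-!
# Route `KLProgramme` — engine support, route (L2), FAT layer 3/4: the fat pair `F̃_ω·F̃_{ω′}` of `bgmFatMultiplier` on an admissible frame IS
# a sampled mixed-pair symbol — identification, the neighbour index sets (`⊆ range N`, `≤ 3` elements, Fermi points within `Lip·w_n`),
# and the support of one fat multiplier

Cell `gate-hubbard-kl`, seat hubbard-kl-k3c2-p3; gen-4 ENGINE child stmt-HubbardSuperconductivity-19855 (`stub_engine_step_norms`, propagator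
`α_n`).  With `n = m + 1 ≥ 1`, `Ft_ω = bgmFatMultiplier L M e₀ β (nambuXiCT L μ K) (m+1) ω` has radial factor `C_{−m}⁻¹(√u) = G_m(u)`
(`gnScaleCutoff_sqrt_eq_bgmCutoffSq`) and angular factor `Σ_{a ∈ S_ω} ζ̃_{m+1,a}(θ)`, `S_ω = {ω′ < N : ω′ ≡ ω, ω ± 1 (mod N)}`.  Proved:

* `fatNbr_subset_range`, `mem_fatNbr_iff`, **`card_fatNbr_le_three`**, **`norm_klFermiPoint_fatNbr_sub_le`** (`a ∈ S_ω ⇒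
  ‖p_F(θ_{n,a}) − p_F(θ_{n,ω})‖ ≤ π√2(1 + (4+2A)/(Dt_min − 2A))·w_n`, by `2π`-periodicity and the Lipschitz bound of the frame's Fermi point);
* **`bgmFat_mul_bgmFat_eq_symbol`** — `Ft_ω(k q)·Ft_{ω′}(k q) = Φ(π(1−2M)/β + (2π/β)val q₁, (2π/L)q̃₂)` with `Φ = G_mG_m(k₀² + e_K²)·Z_fat`
  (`Z_fat` of `…FatAngularFactor` with `S₁ = S_ω`, `S₂ = S_{ω′}`) — the `hGsΦ` of `…FatMultiplierPack`;
* `bgmFat_support_angle` — `Ft_ω(k) ≠ 0 ⇒ ∃ a ∈ S_ω, ζ̃_{n,a}(θ(k)) ≠ 0`.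

Everything is proved; no definitions, no named facts. [folklore]

References: G. Benfatto, A. Giuliani, V. Mastropietro, Ann. Henri Poincaré 7 (2006) 809–898, §2.7 (2.66).
-/

noncomputable section

namespace Summit.HubbardSuperconductivity.HubbardSuperconductivity.Theorems.TorusFourierL2

set_option linter.dupNamespace false -- summit = problem name (single-conjunct summit), D-0017

open Set Finset Literature.MathematicalPhysics.QuantumLattice Literature.MathematicalPhysics.QuantumLattice.BandSectorCounting
open Literature.MathematicalPhysics.QuantumLattice.FermiRG Literature.Probability.LatticeModels Literature.Analysis.SpecialFunctions
open Summit.HubbardSuperconductivity.HubbardSuperconductivity.Theorems.DispersionFlow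
open Summit.HubbardSuperconductivity.HubbardSuperconductivity.Theorems.KLRegimeSplit
open Summit.HubbardSuperconductivity.HubbardSuperconductivity.Theorems.KLProgrammeLegKernels
open Summit.HubbardSuperconductivity.HubbardSuperconductivity.Theorems.PerturbedFermiCurve
open scoped Real Nat

/-! ### §1 The neighbour index sets of the fat multiplier -/

section Nbr

open Classical

/-- The neighbour set is inside one period. [folklore] -/
theorem fatNbr_subset_range (n ω : ℕ) :
    (range (sectorCount n)).filter (fun ω' : ℕ => ∃ δ : ℤ, |δ| ≤ 1 ∧ (sectorCount n : ℤ) ∣ ((ω' : ℤ) - ((ω : ℕ) : ℤ) - δ)) ⊆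
      range (sectorCount n) :=
  filter_subset _ _

/-- **At most three neighbours**: every element of `S_ω` is `(ω + δ) mod N` for some `δ ∈ {−1, 0, 1}`. [folklore] -/
theorem card_fatNbr_le_three (n ω : ℕ) :
    ((range (sectorCount n)).filter (fun ω' : ℕ => ∃ δ : ℤ, |δ| ≤ 1 ∧ (sectorCount n : ℤ) ∣ ((ω' : ℤ) - ((ω : ℕ) : ℤ) - δ))).card ≤ 3 := by
  set N : ℕ := sectorCount n with hN
  have hNpos : 0 < N := sectorCount_pos n
  -- the candidate map `δ ↦ ((ω + δ) mod N).toNat` on `{-1, 0, 1}`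
  let f : ℤ → ℕ := fun δ => ((((ω : ℕ) : ℤ) + δ) % (N : ℤ)).toNat
  have hsub : (range N).filter (fun ω' : ℕ => ∃ δ : ℤ, |δ| ≤ 1 ∧ (N : ℤ) ∣ ((ω' : ℤ) - ((ω : ℕ) : ℤ) - δ)) ⊆
      ({-1, 0, 1} : Finset ℤ).image f := by
    intro ω' hω'
    rw [Finset.mem_filter, Finset.mem_range] at hω'
    obtain ⟨hlt, δ, hδ, hdvd⟩ := hω'
    rw [Finset.mem_image]
    refine ⟨δ, ?_, ?_⟩
    · rw [abs_le] at hδ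
      simp only [Finset.mem_insert, Finset.mem_singleton]
      omega
    · have h := eq_emod_of_dvd_sub (s := ((ω : ℕ) : ℤ) + δ) (ω := ((ω' : ℕ) : ℤ)) (d := 0) (by positivity) (by exact_mod_cast hlt)
        (by obtain ⟨q, hq⟩ := hdvd; exact ⟨-q, by linarith⟩)
      show ((((ω : ℕ) : ℤ) + δ) % (N : ℤ)).toNat = ω'
      rw [sub_zero] at h
      rw [← h]; simp
  calc _ ≤ (({-1, 0, 1} : Finset ℤ).image f).card := card_le_card hsub
    _ ≤ ({-1, 0, 1} : Finset ℤ).card := card_image_le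
    _ ≤ 3 := by decide

variable {a b : ℝ} (B : BandBounds a b) {K : TrigPolyC4v} {A : ℝ}
  (hA : ∀ p : Momentum, ∀ j ≤ 2, ‖iteratedFDeriv ℝ j (frameShift K) p‖ ≤ A) {μ : ℝ} (hlo : a ≤ μ - A) (hhi : μ + A ≤ b)
  (hDt : 2 * A < B.Dtmin)

include B hA hlo hhi hDt in
/-- **Fermi points of neighbouring sectors are close**: for `a ∈ S_ω`,
`‖p_F(θ_{n,a}) − p_F(θ_{n,ω})‖ ≤ π√2·(1 + (4+2A)/(Dt_min − 2A))·w_n` (sup norm). [folklore] -/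
theorem norm_klFermiPoint_fatNbr_sub_le (n ω : ℕ) {a' : ℕ}
    (ha' : a' ∈ (range (sectorCount n)).filter (fun ω' : ℕ => ∃ δ : ℤ, |δ| ≤ 1 ∧ (sectorCount n : ℤ) ∣ ((ω' : ℤ) - ((ω : ℕ) : ℤ) - δ))) :
    ‖klFermiPoint μ K (sectorCenter n a') - klFermiPoint μ K (sectorCenter n ω)‖ ≤
      π * Real.sqrt 2 * (1 + (4 + 2 * A) / (B.Dtmin - 2 * A)) * sectorWidth n := by
  rw [Finset.mem_filter] at ha'
  obtain ⟨-, δ, hδ, k, hk⟩ := ha'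
  -- `θ_{n,a} = θ_{n,ω} + δ·w_n + 2π·k`
  have hNw : (sectorCount n : ℝ) * sectorWidth n = 2 * π := sectorCount_mul_sectorWidth n
  have hcent : sectorCenter n a' = (sectorCenter n ω + (δ : ℝ) * sectorWidth n) + (k : ℤ) • (2 * π) := by
    rw [sectorCenter, sectorCenter, zsmul_eq_mul, ← hNw]
    have hk' : ((a' : ℕ) : ℝ) = ((ω : ℕ) : ℝ) + (δ : ℝ) + (sectorCount n : ℝ) * (k : ℝ) := by
      have : ((a' : ℕ) : ℤ) = ((ω : ℕ) : ℤ) + δ + (sectorCount n : ℤ) * k := by linarith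
      exact_mod_cast this
    rw [hk']; ring
  have hper : Function.Periodic (klFermiPoint μ K) (2 * π) := fun θ => by
    unfold klFermiPoint; rw [perturbedFermiRadius_add_two_pi, dir_add_two_pi]
  rw [hcent, (hper.zsmul k) (sectorCenter n ω + (δ : ℝ) * sectorWidth n)]
  have hL := norm_klFermiPoint_sub_le B hA hlo hhi hDt (sectorCenter n ω + (δ : ℝ) * sectorWidth n) (sectorCenter n ω)
  have hw : 0 < sectorWidth n := sectorWidth_pos n
  have hδ' : |(δ : ℝ)| ≤ 1 := by exact_mod_cast hδ
  have hdiff : |sectorCenter n ω + (δ : ℝ) * sectorWidth n - sectorCenter n ω| ≤ sectorWidth n := by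
    rw [add_sub_cancel_left, abs_mul, abs_of_pos hw]
    calc |(δ : ℝ)| * sectorWidth n ≤ 1 * sectorWidth n := mul_le_mul_of_nonneg_right hδ' hw.le
      _ = sectorWidth n := one_mul _
  have hC : 0 ≤ π * Real.sqrt 2 * (1 + (4 + 2 * A) / (B.Dtmin - 2 * A)) := by
    have hA0 : 0 ≤ A := (norm_nonneg _).trans (hA 0 0 (by norm_num))
    have : 0 < B.Dtmin - 2 * A := by linarith
    positivity
  exact hL.trans (mul_le_mul_of_nonneg_left hdiff hC)

end Nbr

/-! ### §2 The identification and the support of one fat multiplier -/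

section Ident

open Classical

variable {L M : ℕ} [NeZero L] [NeZero M] {K : TrigPolyC4v} {A : ℝ}
  (hA : ∀ p : Momentum, ∀ j ≤ 2, ‖iteratedFDeriv ℝ j (frameShift K) p‖ ≤ A)
  {μ e₀ z β : ℝ} (he : 0 < e₀) (hz : 0 < z) (h3 : e₀ + A - μ ≤ 3)
  (m : ℕ) (ω₁ ω₂ : Fin (sectorCount (m + 1)))
  {Z : (Fin 2 → ℝ) → ℝ}
  (hZ : ∀ p, Z p = gnCutoff ((π + z) ^ 2 / π ^ 2) ((π + z) ^ 2) (p 0 ^ 2) * gnCutoff ((π + z) ^ 2 / π ^ 2) ((π + z) ^ 2) (p 1 ^ 2) *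
    ((radialCutoffC (1 / 2) (momToComplex p) *
        ∑ a' ∈ (range (sectorCount (m + 1))).filter
          (fun ω' : ℕ => ∃ δ : ℤ, |δ| ≤ 1 ∧ (sectorCount (m + 1) : ℤ) ∣ ((ω' : ℤ) - ((ω₁ : ℕ) : ℤ) - δ)),
          sectorWeightCirc (m + 1) ((a' : ℕ) : ℤ) (polarAngle p)) *
      (radialCutoffC (1 / 2) (momToComplex p) *
        ∑ b' ∈ (range (sectorCount (m + 1))).filter
          (fun ω' : ℕ => ∃ δ : ℤ, |δ| ≤ 1 ∧ (sectorCount (m + 1) : ℤ) ∣ ((ω' : ℤ) - ((ω₂ : ℕ) : ℤ) - δ)),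
          sectorWeightCirc (m + 1) ((b' : ℕ) : ℤ) (polarAngle p))))
  {Φ : ℝ × (Fin 2 → ℝ) → ℂ}
  (hΦ : ∀ k₀ p, Φ (k₀, p) = ((bgmCutoffSq e₀ ((16 : ℝ) ^ m * (k₀ ^ 2 + frameLevel μ K (WithLp.toLp 2 p) ^ 2)) *
      bgmCutoffSq e₀ ((16 : ℝ) ^ m * (k₀ ^ 2 + frameLevel μ K (WithLp.toLp 2 p) ^ 2)) * Z p : ℝ) : ℂ))

omit [NeZero L] [NeZero M] in
/-- **One fat multiplier, unfolded on a frame**: `Ft_ω(k) = C_{−m}⁻¹(√u)·Σ_{a∈S_ω} ζ̃_{m+1,a}(θ(k))`, `u = ω_k² + e_K(k)²`, with the radial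
factor in profile form `G_m(u)`. [cite: BenfattoGiulianiMastropietro2006, §2.7 (2.66)] -/
theorem bgmFat_apply (ω : Fin (sectorCount (m + 1))) (k : FreqMomentum L M) :
    bgmFatMultiplier L M e₀ β (nambuXiCT L μ K) (m + 1) ω k =
      ((bgmCutoffSq e₀ ((16 : ℝ) ^ m * (matsubaraFreq β M k.1 ^ 2 + nambuXiCT L μ K k.2 ^ 2)) *
        ∑ a' ∈ (range (sectorCount (m + 1))).filter
          (fun ω' : ℕ => ∃ δ : ℤ, |δ| ≤ 1 ∧ (sectorCount (m + 1) : ℤ) ∣ ((ω' : ℤ) - ((ω : ℕ) : ℤ) - δ)),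
          sectorWeightCirc (m + 1) ((a' : ℕ) : ℤ) (momentumAngle L k.2) : ℝ) : ℂ) := by
  rw [bgmFatMultiplier]
  have hidx : (-((m + 1 : ℕ) : ℤ) + 1) = -(m : ℤ) := by push_cast; ring
  rw [hidx, gnScaleCutoff_sqrt_eq_bgmCutoffSq]

include hA h3 he hz hZ hΦ in
/-- **The fat pair IS the sample of the continuum symbol**: for every product-torus label `q`,
`Ft_{ω₁}(k(q))·Ft_{ω₂}(k(q)) = Φ(π(1−2M)/β + (2π/β)·val q₁, (2π/L)·q̃₂)`. [cite: BenfattoGiulianiMastropietro2006, §2.7 (2.66)] -/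
theorem bgmFat_mul_bgmFat_eq_symbol (q : TorusSite 1 (2 * M) × TorusSite 2 L) :
    bgmFatMultiplier L M e₀ β (nambuXiCT L μ K) (m + 1) ω₁ (⟨(q.1 0).val, ZMod.val_lt (q.1 0)⟩, q.2) *
        bgmFatMultiplier L M e₀ β (nambuXiCT L μ K) (m + 1) ω₂ (⟨(q.1 0).val, ZMod.val_lt (q.1 0)⟩, q.2) =
      Φ (π * (1 - 2 * M) / β + 2 * π / β * (((q.1 0).val : ℕ) : ℝ), fun j => 2 * π / L * (((q.2 j).valMinAbs : ℤ) : ℝ)) := by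
  have hsp := sampledPoint_eq (L := L) (M := M) β q
  rw [← hsp, hΦ, bgmFat_apply (μ := μ) (e₀ := e₀) (β := β) m ω₁, bgmFat_apply (μ := μ) (e₀ := e₀) (β := β) m ω₂, ← Complex.ofReal_mul]
  set k₀ : ℝ := matsubaraFreq β M (⟨(q.1 0).val, ZMod.val_lt (q.1 0)⟩ : MatsubaraIdx M) with hk₀
  set c : Fin 2 → ℝ := torusCentredMomentum L q.2 with hc
  have he_eq : nambuXiCT L μ K q.2 = frameLevel μ K (WithLp.toLp 2 c) := nambuXiCT_eq_frameLevel L μ K q.2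
  have hang : momentumAngle L q.2 = polarAngle c := rfl
  rw [he_eq, hang]
  congr 1
  set u : ℝ := k₀ ^ 2 + frameLevel μ K (WithLp.toLp 2 c) ^ 2 with hu
  -- the square cutoff is `1` at the sample point
  have hcπ : ∀ j, |c j| ≤ π := abs_torusCentredMomentum_le_pi L q.2
  have hsq : ∀ j, gnCutoff ((π + z) ^ 2 / π ^ 2) ((π + z) ^ 2) (c j ^ 2) = 1 := fun j =>
    sqCutoff_eq_one hz (by rw [← sq_abs]; exact pow_le_pow_left₀ (abs_nonneg _) (hcπ j) 2)
  rw [hZ c, hsq 0, hsq 1, one_mul, one_mul]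
  by_cases hR : (1 : ℝ) / 2 ≤ ‖momToComplex c‖
  · rw [radialCutoffC_eq_one (by norm_num) hR, one_mul, one_mul]
    ring
  · have hnot : ¬ (1 : ℝ) ≤ ‖momToComplex c‖ := fun h1 => hR (by linarith)
    have hbig : e₀ < |frameLevel μ K (WithLp.toLp 2 c)| := by
      by_contra hle
      exact hnot (one_le_norm_of_frameBand_le hA h3 (not_lt.1 hle))
    have h1 : gnScaleCutoff 4 e₀ (-(m : ℤ)) (Real.sqrt u) = 0 := gnScaleCutoff_eq_zero_of_band_gt he m hbig
    have h1' : bgmCutoffSq e₀ ((16 : ℝ) ^ m * u) = 0 := by rw [← gnScaleCutoff_sqrt_eq_bgmCutoffSq]; exact h1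
    rw [h1']; ring

omit [NeZero L] [NeZero M] in
/-- **Support of one fat multiplier, angular part**: `Ft_ω(k) ≠ 0 ⇒ ∃ a ∈ S_ω, ζ̃_{m+1,a}(θ(k)) ≠ 0`. [folklore] -/
theorem bgmFat_support_angle (ω : Fin (sectorCount (m + 1))) (k : FreqMomentum L M)
    (h : bgmFatMultiplier L M e₀ β (nambuXiCT L μ K) (m + 1) ω k ≠ 0) :
    ∃ a' ∈ (range (sectorCount (m + 1))).filter
        (fun ω' : ℕ => ∃ δ : ℤ, |δ| ≤ 1 ∧ (sectorCount (m + 1) : ℤ) ∣ ((ω' : ℤ) - ((ω : ℕ) : ℤ) - δ)),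
      sectorWeightCirc (m + 1) ((a' : ℕ) : ℤ) (momentumAngle L k.2) ≠ 0 := by
  rw [bgmFat_apply (μ := μ) (e₀ := e₀) (β := β) m ω k, Complex.ofReal_ne_zero] at h
  exact exists_ne_zero_of_sum_ne_zero (mul_ne_zero_iff.1 h).2

include he in
omit [NeZero L] [NeZero M] in
/-- **Support of one fat multiplier, radial part**: `Ft_ω(k) ≠ 0 ⇒ G_m(ω_k² + e_K(k)²) ≠ 0`, hence `ω_k² + e_K(k)² ≤ Λ_m²`. [folklore] -/
theorem bgmFat_support_shell (ω : Fin (sectorCount (m + 1))) (k : FreqMomentum L M)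
    (h : bgmFatMultiplier L M e₀ β (nambuXiCT L μ K) (m + 1) ω k ≠ 0) :
    matsubaraFreq β M k.1 ^ 2 + nambuXiCT L μ K k.2 ^ 2 ≤ klScale e₀ m ^ 2 := by
  rw [bgmFat_apply (μ := μ) (e₀ := e₀) (β := β) m ω k, Complex.ofReal_ne_zero] at h
  have hG := (mul_ne_zero_iff.1 h).1
  by_contra hlt
  push Not at hlt
  obtain ⟨d, -, hd1, hd2⟩ := exists_abs_derivs_bgmCutoffSq_le he
  exact hG ((scaleProfile_bounds he m hd1 hd2).2.2.2.2 _ hlt)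

end Ident

end Summit.HubbardSuperconductivity.HubbardSuperconductivity.Theorems.TorusFourierL2

end
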